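import Summits.ResolutionOfSingularities.ResolutionOfSingularities.Theorems.EquisingularLiftEquisingularLiftNatClusterStepTangentDefs
import Summits.ResolutionOfSingularities.ResolutionOfSingularities.Theorems.EquisingularLiftEquisingularLiftNatSubchainPointResolutionOff
import HarnessLib

/-!
# [OURS · L1 W4.5(b) · EL♮(3)] HSUB′(ReachTCPlusPlus₂) FROM AN INVARIANT — the induction DRIVER of the sub-chain supplier for rung v7′ (TC⁺⁺)
# (registered stub `stub_elnat_tcPlusPlusPointResolution` v2, child v11 011c3f984dc7a8e2 / parent v14 56923c4a820904d0; res-L1-w45b-lead-2's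
# INST v2 `stub_elnat_tcPlusPlusTangentPointResolution_of_subchainLift` p538683 over res-D-pv-029's K5′ `target_elnat_of_subchainResolution'`)

Crux `EquisingularLiftNat` = stmt-ResolutionOfSingularities-20038 (child EL♮(3) = stmt-ResolutionOfSingularities-20148), route EquisingularLift, line
`sections`. Helper file `--supports stmt-ResolutionOfSingularities-20148 --as helper` by res-L1-w45b-stub-3 (object (α) of the TC⁺⁺ board,
res-L1-w45b-plan-1 WORD 2026-08-27T15:07:43Z «(α) NOW: INV″ Defs + the ≈ 30-line driver variant of p526242 with the exceptional tracker X»).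
HONEST FRAMING: OURS (cell res-hironaka, slot W4.5(b)); NOT a statement of any manuscript; AI-written, weaker than expert review.
No `sorry`; standard axioms. It closes nothing by itself.

WHAT. `hsub_reachTCPlusPlus_of_invariant`: res-L1-w45b-stub-1's driver `hsub_reachTCPlus_of_invariant` (…NatSubchainSupplierDriver, p526242)
with the v7 Bool flag replaced by the EXCEPTIONAL TRACKER `X : Set G` of `ClusterReach` (…NatClusterStepDefs, p531557) and the point-step
base datum `CarrierCluster₂` (…NatClusterStepTangentDefs, p536699): the sub-chain supplier hypothesis HSUB′(ReachTCPlusPlus₂) of the INST v2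
(its text VERBATIM: the common K5′ prefix, then `∀ F₁₀ β T₁₀, ReachTCPlusPlus₂ F₁ F₂ υ x (closure υ⁻¹(T₁ ∖ {x})) F₁₀ β T₁₀ → ∃ X₉ σ₉ S₉ j₉ t₉, …`)
follows from THREE hypotheses on an invariant `INV W G β T Z X` of the inner chain — (base) `INV` at `(F₂, 𝟙, T₂, Z₂, ∅)` from the rung's
`W`-clauses and `CarrierCluster₂`; (step) `INV` is preserved by the `ClusterReach` step (blow-up of a closed point `y ∈ T` of the reduced running
curve at which the stage is regular and which is either a regular point of the curve or a non-regular point NOT in the tracker; tracker update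
`X ↦ closure υ₁⁻¹(X ∖ {y}) ∪ υ₁⁻¹{y}`); (final) the curve step from `INV`. PROOF = unpack `ReachTCPlusPlus₂`, run the `ClusterReach` closure at
`R := INV W`, finish with (final). Pure logic; it FIXES THE INTERFACES of the TC⁺⁺ bricks (`inv_base″` = (δ) STEP 0 per subset, `inv_step″` = (ε)
at a general point + res-L1-w45b-stub-1's regular step, `inv_final″` = …NatInCarrierCurveStep / `curveStep_of_inv` pattern) so that they can be
built independently. The intended `INV″` (one `TCPlus.Member` per subset of the untracked candidate centres) is a separate Defs file;
this file is agnostic of it.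

References: res-L1-w45b-stub-1 …NatSubchainSupplierDriver (p526242); res-L1-w45b-lead-2 …NatClusterStepDefs (p531557), …NatClusterStepTangentDefs
(p536699), INST v2 (p538683); res-D-pv-029 K5′ (…NatSubchainPointResolutionOff). OURS planning texts (TCPP-SUPPLIER-MAP §2), index only.
-/

set_option linter.dupNamespace false -- mandated namespace `Summit.<Summit>.<Problem>` of this single-conjunct summit
set_option linter.overlappingInstances false -- signatures carry `[IsDomain O] [IsDiscreteValuationRing O]`

noncomputable section

open CategoryTheory CategoryTheory.Limits AlgebraicGeometry TopologicalSpace Topology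
open Literature.AlgebraicGeometry.Resolution
open AlgebraicGeometry.Scheme.IdealSheafData

namespace Summit.ResolutionOfSingularities.ResolutionOfSingularities.Cruxes.EquisingularLiftNat.Sections

/-- **HSUB′(ReachTCPlusPlus₂) from an invariant of the inner chain with exceptional tracker** (the TC⁺⁺ induction driver; see the module
docstring). [folklore; pure logic over res-D-pv-029's K5′ binders and res-L1-w45b-lead-2's `ReachTCPlusPlus₂` / `ClusterReach`] [OURS · L1 W4.5b] toward
`stub_elnat_tcPlusPlusPointResolution` (v2); NOT a statement of the manuscript. -/
theorem hsub_reachTCPlusPlus_of_invariant (k : Type) [Field k] (n : ℕ) :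
    ∀ (O : Type) [CommRing O] [IsDomain O] [IsDiscreteValuationRing O] [IsAdicComplete (IsLocalRing.maximalIdeal O) O] [IsAlgClosed (IsLocalRing.ResidueField O)] (θ : O →+* k), Function.Surjective θ → ∀ (P : AlgebraicGeometry.Scheme.{0}) (q : P ⟶ AlgebraicGeometry.Spec (.of O)) (Y : Set P) (Ch : ∀ X' : AlgebraicGeometry.Scheme.{0}, (X' ⟶ P) → Set X' → Prop), (∀ (X' X'' : AlgebraicGeometry.Scheme.{0}) (σ' : X' ⟶ P) (S' : Set X') (C : X'.IdealSheafData) (τ : X'' ⟶ X'), Ch X' σ' S' → Literature.AlgebraicGeometry.Resolution.IsBlowup τ C → Literature.AlgebraicGeometry.Resolution.Scheme.IsRegular C.subscheme → AlgebraicGeometry.Flat (C.subschemeι ≫ σ' ≫ q) → σ' '' (C.support : Set X') ⊆ {y | ¬ IsGenericPoint y Y} → (C.support : Set X') ∩ (σ' ≫ q) ⁻¹' {IsLocalRing.closedPoint O} ⊆ S' → Ch X'' (τ ≫ σ') (closure (τ ⁻¹' (S' \ (C.support : Set X'))))) → (∀ (X' : AlgebraicGeometry.Scheme.{0}) (σ'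 : X' ⟶ P) (S' : Set X'), Ch X' σ' S' → Summit.ResolutionOfSingularities.ResolutionOfSingularities.Theses.EquisingularLift.Split.Chain P Y X' σ' S') → Y ⊆ q ⁻¹' {IsLocalRing.closedPoint O} → IsIrreducible Y → IsClosed Y → AlgebraicGeometry.IsIntegral P → IsLocallyNoetherian P → Literature.AlgebraicGeometry.Resolution.Scheme.IsRegular P → AlgebraicGeometry.IsProper q → AlgebraicGeometry.SmoothOfRelativeDimension n q → ∀ (X' : AlgebraicGeometry.Scheme.{0}) (σ' : X' ⟶ P) (S' : Set X'), Ch X' σ' S' → AlgebraicGeometry.IsIntegral X' → IsLocallyNoetherian X' → Literature.AlgebraicGeometry.Resolution.Scheme.IsRegular X' → AlgebraicGeometry.IsDominant (σ' ≫ q) → ∀ (F₁ : AlgebraicGeometry.Scheme.{0}), AlgebraicGeometry.IsIntegral F₁ → ∀ (j : F₁ ⟶ X') (t : F₁ ⟶ AlgebraicGeometry.Spec (.of k)), IsPullback j t (σ' ≫ q) (AlgebraicGeometry.Spec.map (CommRingCat.ofHom θ)) → ∀ (T₁ : Set F₁), IsClosed T₁ → IsIrreducible T₁ → j '' T₁ =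 S' → ∀ (x : F₁) (hx : IsClosed ({x} : Set F₁)) (U : X'.Opens), AlgebraicGeometry.Smooth (U.ι ≫ σ' ≫ q) → ∀ (s : AlgebraicGeometry.Spec (.of O) ⟶ X'), s ≫ σ' ≫ q = 𝟙 _ → s (IsLocalRing.closedPoint O) ∈ U → s (IsLocalRing.closedPoint O) = j x → ringKrullDim (X'.presheaf.stalk (s (IsLocalRing.closedPoint O))) = ((n + 1 : ℕ) : WithBot ℕ∞) → IsRegularLocalRing (F₁.presheaf.stalk x) → (∀ c ∈ (s.ker.support : Set X'), ¬ IsGenericPoint (σ' c) Y) → ∀ (X₁ : AlgebraicGeometry.Scheme.{0}) (τ₁ : X₁ ⟶ X'), Literature.AlgebraicGeometry.Resolution.IsBlowup τ₁ s.ker → AlgebraicGeometry.IsIntegral X₁ → IsLocallyNoetherian X₁ → Literature.AlgebraicGeometry.Resolution.Scheme.IsRegular X₁ → AlgebraicGeometry.IsDominant ((τ₁ ≫ σ') ≫ q) → ∀ (F₂ : AlgebraicGeometry.Scheme.{0}), AlgebraicGeometry.IsIntegral F₂ → ∀ (υ : F₂ ⟶ F₁), Literature.AlgebraicGeometry.Resolution.IsBlowup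 υ (AlgebraicGeometry.Scheme.IdealSheafData.vanishingIdeal (⟨{x}, hx⟩ : TopologicalSpace.Closeds F₁)) → ∀ (j₂ : F₂ ⟶ X₁) (t₂ : F₂ ⟶ AlgebraicGeometry.Spec (.of k)), IsPullback j₂ t₂ ((τ₁ ≫ σ') ≫ q) (AlgebraicGeometry.Spec.map (CommRingCat.ofHom θ)) → j₂ ≫ τ₁ = υ ≫ j → (s.ker.comap τ₁).comap j₂ = (AlgebraicGeometry.Scheme.IdealSheafData.vanishingIdeal (⟨{x}, hx⟩ : TopologicalSpace.Closeds F₁)).comap υ → IsIrreducible (closure (υ ⁻¹' (T₁ \ {x}))) → Ch X₁ (τ₁ ≫ σ') (j₂ '' closure (υ ⁻¹' (T₁ \ {x}))) → ∀ (INV : Set F₁ → ∀ G : AlgebraicGeometry.Scheme.{0}, (G ⟶ F₂) → Set G → Set G → Set G → Prop),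
      -- (base) the invariant after the point step, for every admissible `W` with a carrier cluster
      (∀ W : Set F₁, (x ∈ W) → (¬ (υ ⁻¹' {x} ⊆ closure (υ ⁻¹' (W \ {x})))) → ((∃ U : F₁.affineOpens, x ∈ (U : F₁.Opens) ∧ ((AlgebraicGeometry.Scheme.IdealSheafData.vanishingIdeal (⟨closure W, isClosed_closure⟩ : TopologicalSpace.Closeds F₁)).ideal U).IsPrincipal)) → ((υ ⁻¹' {x} ∩ closure (υ ⁻¹' (W \ {x}))) ⊆ closure (υ ⁻¹' (T₁ \ {x}))) → CarrierCluster₂ F₁ F₂ υ x W → INV W F₂ (CategoryTheory.CategoryStruct.id F₂) (closure (υ ⁻¹' (T₁ \ {x}))) (υ ⁻¹' {x} ∩ closure (υ ⁻¹' (W \ {x}))) ∅) →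
      -- (step) an in-carrier point blow-up at a closed point of the running curve: regular, or non-regular OUTSIDE the tracker `X`
      (∀ W : Set F₁, ∀ (G₁ G₂ : AlgebraicGeometry.Scheme.{0}) (β : G₁ ⟶ F₂) (T Z X : Set G₁) (y : redSub G₁ (closure Z) isClosed_closure) (υ₁ : G₂ ⟶ G₁) (hy : IsClosed ({(redSubι G₁ (closure Z) isClosed_closure y : G₁)} : Set G₁)), INV W G₁ β T Z X → (redSubι G₁ (closure Z) isClosed_closure y : G₁) ∈ T → IsRegularLocalRing (G₁.presheaf.stalk (redSubι G₁ (closure Z) isClosed_closure y)) → (IsRegularLocalRing ((redSub G₁ (closure Z) isClosed_closure).presheaf.stalk y) ∨ (¬ IsRegularLocalRing ((redSub G₁ (closure Z) isClosed_closure).presheaf.stalk y) ∧ (redSubι G₁ (closure Z) isClosed_closure y : G₁) ∉ X)) → Literature.AlgebraicGeometry.Resolution.IsBlowup υ₁ (AlgebraicGeometry.Scheme.IdealSheafData.vanishingIdeal (⟨{(redSubι G₁ (closure Z) isClosed_closure y : G₁)}, hy⟩ : TopologicalSpace.Closeds G₁)) → INV W G₂ (υ₁ ≫ β) (closure (υ₁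 ⁻¹' (T \ {(redSubι G₁ (closure Z) isClosed_closure y : G₁)}))) (closure (υ₁ ⁻¹' (Z \ {(redSubι G₁ (closure Z) isClosed_closure y : G₁)}))) (closure (υ₁ ⁻¹' (X \ {(redSubι G₁ (closure Z) isClosed_closure y : G₁)})) ∪ υ₁ ⁻¹' {(redSubι G₁ (closure Z) isClosed_closure y : G₁)})) →
      -- (final) the curve step from the invariant
      (∀ (W : Set F₁) (F₉ : AlgebraicGeometry.Scheme.{0}) (β₉ : F₉ ⟶ F₂) (T₉ Z₉ X₉ : Set F₉) (hZ₉ : IsClosed Z₉) (F₁₀ : AlgebraicGeometry.Scheme.{0}) (υ' : F₁₀ ⟶ F₉), INV W F₉ β₉ T₉ Z₉ X₉ → (Z₉ ⊆ T₉) → (¬ (T₉ ⊆ Z₉)) → (Set.Finite {z : ↥((AlgebraicGeometry.Scheme.IdealSheafData.vanishingIdeal (⟨Z₉, hZ₉⟩ : TopologicalSpace.Closeds F₉))).subscheme | ¬ IsRegularLocalRing (((AlgebraicGeometry.Scheme.IdealSheafData.vanishingIdeal (⟨Z₉, hZ₉⟩ : TopologicalSpace.Closeds F₉))).subscheme.presheaf.stalk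 z)}) → (Literature.AlgebraicGeometry.Resolution.IsBlowup υ' (AlgebraicGeometry.Scheme.IdealSheafData.vanishingIdeal (⟨Z₉, hZ₉⟩ : TopologicalSpace.Closeds F₉))) → ∃ (X₉ : AlgebraicGeometry.Scheme.{0}) (σ₉ : X₉ ⟶ P) (S₉ : Set X₉) (j₉ : F₁₀ ⟶ X₉) (t₉ : F₁₀ ⟶ AlgebraicGeometry.Spec (.of k)), Ch X₉ σ₉ S₉ ∧ AlgebraicGeometry.IsIntegral X₉ ∧ IsLocallyNoetherian X₉ ∧ Literature.AlgebraicGeometry.Resolution.Scheme.IsRegular X₉ ∧ AlgebraicGeometry.IsDominant (σ₉ ≫ q) ∧ IsPullback j₉ t₉ (σ₉ ≫ q) (AlgebraicGeometry.Spec.map (CommRingCat.ofHom θ)) ∧ j₉ '' closure (υ' ⁻¹' (T₉ \ Z₉)) = S₉ ∧ IsClosed (closure (υ' ⁻¹' (T₉ \ Z₉))) ∧ IsIrreducible (closure (υ' ⁻¹' (T₉ \ Z₉))) ∧ AlgebraicGeometry.IsIntegral F₁₀) →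
      ∀ (F₁₀ : AlgebraicGeometry.Scheme.{0}) (β : F₁₀ ⟶ F₂) (T₁₀ : Set F₁₀), ReachTCPlusPlus₂ F₁ F₂ υ x (closure (υ ⁻¹' (T₁ \ {x}))) F₁₀ β T₁₀ → ∃ (X₉ : AlgebraicGeometry.Scheme.{0}) (σ₉ : X₉ ⟶ P) (S₉ : Set X₉) (j₉ : F₁₀ ⟶ X₉) (t₉ : F₁₀ ⟶ AlgebraicGeometry.Spec (.of k)), Ch X₉ σ₉ S₉ ∧ AlgebraicGeometry.IsIntegral X₉ ∧ IsLocallyNoetherian X₉ ∧ Literature.AlgebraicGeometry.Resolution.Scheme.IsRegular X₉ ∧ AlgebraicGeometry.IsDominant (σ₉ ≫ q) ∧ IsPullback j₉ t₉ (σ₉ ≫ q) (AlgebraicGeometry.Spec.map (CommRingCat.ofHom θ)) ∧ j₉ '' T₁₀ = S₉ ∧ IsClosed (T₁₀) ∧ IsIrreducible (T₁₀) ∧ AlgebraicGeometry.IsIntegral F₁₀ := by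
  intro O _ _ _ _ _ θ hθ P q Y Ch hChStep hChSplit hYsp hYirr hYcl hPint hPnoeth hPreg hqprop hqsm X' σ' S' hCh' hX'int hX'noeth
    hX'reg hX'dom F₁ hF₁ j t hsq T₁ hT₁cl hT₁irr hjT₁ x hx U hU s hs hsU hsx hdim hxreg hsoff X₁ τ₁ hτ₁ hX₁int hX₁noeth hX₁reg
    hX₁dom F₂ hF₂ υ hυ j₂ t₂ hsq₂ hcomm hcarrier hirr₂ hCh₁ INV hbase hstep hfinal F₁₀ β T₁₀ hReach
  obtain ⟨W, F₉, β₉, T₉, Z₉, hZ₉, υ', hxW, hnot, hWpr, hZ₂T₂, hCC, hCR, hZ₉T₉, hT₉Z₉, hfin₉, hυ', hβ, hT₁₀⟩ := hReach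
  obtain ⟨X₉, hinner⟩ := hCR
  subst hβ hT₁₀
  exact hfinal W F₉ β₉ T₉ Z₉ X₉ hZ₉ F₁₀ υ' (hinner (INV W) (hbase W hxW hnot hWpr hZ₂T₂ hCC) (hstep W)) hZ₉T₉ hT₉Z₉ hfin₉ hυ'

end Summit.ResolutionOfSingularities.ResolutionOfSingularities.Cruxes.EquisingularLiftNat.Sections

end
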